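import Summits.QuantumFields.YangMills.Theorems.EquipartitionCriticalityFreeEnergyLogCoefficientStubExpChartPackage
import Literature.MathematicalPhysics.QuantumFieldTheory.WilsonEnergyConvexity
import Literature.MathematicalPhysics.QuantumFieldTheory.YangMillsOS
import HarnessLib

/-!
# Crux `FemtoCurvatureTwoPoint` (stmt-QuantumFields-9363, route `LangevinControlUV`):
# stub `stub_doubling_of_RV` — doubling of the fixed-torus partition function

Line `generic-step-gamma-encoding` (`--supports stmt-QuantumFields-9363`), closing the registered
stub `stub_doubling_of_RV` verbatim: IF on every torus `(ℤ/L)⁴` the Wilson partition function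
`Z_L(β) = ∫ e^{−β S} dHaar^{⊗E}` of a compact group `G` with a faithful continuous unitary lattice
representation `r` is regularly varying at `β = ∞` in the sharp form
`Z_L(β) β^λ / (log β)^m → C > 0` (`λ ≥ 0`, `m ∈ ℕ`; the named fact `stub_wilsonPartitionRV`,
asymptotics of Laplace integrals with analytic phase), THEN there is ONE `A` (depending on `r`
only) such that on every torus, for `β ≥ B(L)`, `Z_L(β/2) ≤ e^{A L⁴} Z_L(β)`.

Proof.
* (`exp_mul_pow_le_partitionFunction_toReal`, crude Gaussian lower bound) with the small-ball
  constant `C₁` of the landed exponential-chart package (`exists_haar_gball_ge`: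
  `Haar{‖r g − 1‖ ≤ δ} ≥ C₁ δ^D`, `D = dimE r.ρ`, `0 < δ ≤ 1`), for `β ≥ 0`:
  `Z_L(β) ≥ e^{−8 β δ² #P} (C₁ δ^D)^{#E}`, `#E = 4L⁴`, `#P = 6L⁴`. On the product set
  `{∀ e, ‖r(U_e) − 1‖ ≤ δ}` (product-Haar mass `≥ (C₁ δ^D)^{#E}`) every plaquette holonomy has
  `‖r(U_p) − 1‖ ≤ 4δ` (Hilbert–Schmidt norm, unitary invariance), so the plaquette energy is
  `N − Re tr r(U_p) = ½‖1 − r(U_p)‖² ≤ 8δ²`, and the tree's Laplace bound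
  `exp_mul_measureReal_le_integral_exp` applies. With `δ = β⁻¹` (`β ≥ 1`):
  `Z_L(β) ≥ e^{−48 L⁴} (C₁ β^{−D})^{4L⁴}` (`partitionFunction_toReal_ge_inv_pow`; the Gaussian
  scale `δ = (√β)⁻¹` gives exponent `2 D L⁴`, `partitionFunction_toReal_ge_inv_sqrt_pow`).
* (`index_le_of_lowerBound`, real analysis) `Z β^λ/(log β)^m → C` and `Z(β) ≥ c β^{−n}` force
  `λ ≤ n` (`(log β)^m = o(β^{λ−n})` otherwise), here `n = 4 D L⁴`.
* (`le_mul_of_tendsto`) `Z β^λ/(log β)^m → C > 0` alone gives, eventually,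
  `Z(β/2) ≤ 2C (log(β/2))^m 2^λ/β^λ ≤ 4 · 2^λ · (C/2)(log β)^m/β^λ ≤ 4 · 2^λ · Z(β)`.
* `4 · 2^λ ≤ e^{λ + 2} ≤ e^{(4D + 2) L⁴}`: `A := 4 D + 2`.
-/

noncomputable section

open scoped BigOperators Matrix Matrix.Norms.Frobenius ENNReal
open MeasureTheory Filter Topology ProbabilityTheory
open Literature.MathematicalPhysics.QuantumFieldTheory
open Summit.QuantumFields.YangMills.Theorems.FreeEnergyLogCoefficient

namespace Summit.QuantumFields.YangMills.Theorems.FemtoCurvatureTwoPoint.DoublingOfRV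

section Algebra

variable {G : Type*} [Group G] {N : ℕ} (ρ : G →* Matrix (Fin N) (Fin N) ℂ)

/-- Hilbert–Schmidt distance to `1` is subadditive along products seen through a unitary
representation: `‖ρ(gh) − 1‖ ≤ ‖ρ g − 1‖ + ‖ρ h − 1‖`. -/
theorem norm_rho_mul_sub_one_le (hU : ∀ g, ρ g ∈ Matrix.unitaryGroup (Fin N) ℂ) (g h : G) :
    ‖ρ (g * h) - 1‖ ≤ ‖ρ g - 1‖ + ‖ρ h - 1‖ := by
  have e : ρ (g * h) - 1 = ρ g * (ρ h - 1) + (ρ g - 1) := by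
    rw [map_mul, Matrix.mul_sub, Matrix.mul_one]; abel
  rw [e]
  calc ‖ρ g * (ρ h - 1) + (ρ g - 1)‖ ≤ ‖ρ g * (ρ h - 1)‖ + ‖ρ g - 1‖ := norm_add_le _ _
    _ = ‖ρ h - 1‖ + ‖ρ g - 1‖ := by
        rw [Matrix.frobenius_norm_unitaryGroup_mul ⟨ρ g, hU g⟩ (ρ h - 1)]
    _ = ‖ρ g - 1‖ + ‖ρ h - 1‖ := add_comm _ _

/-- `‖ρ g⁻¹ − 1‖ = ‖ρ g − 1‖` for a unitary representation. -/
theorem norm_rho_inv_sub_one (hU : ∀ g, ρ g ∈ Matrix.unitaryGroup (Fin N) ℂ) (g : G) :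
    ‖ρ g⁻¹ - 1‖ = ‖ρ g - 1‖ := by
  have h := norm_rho_sub_rho ρ hU 1 g
  rw [map_one, mul_one, norm_sub_rev] at h
  exact h.symm

/-- On the product ball `{∀ e, ‖ρ(U_e) − 1‖ ≤ δ}` every plaquette holonomy is `4δ`-close to `1`. -/
theorem norm_rho_plaquetteHolonomy_sub_one_le (hU : ∀ g, ρ g ∈ Matrix.unitaryGroup (Fin N) ℂ)
    {L : ℕ} {U : GaugeConfig 4 L G} {δ : ℝ} (hUδ : ∀ e, ‖ρ (U e) - 1‖ ≤ δ)
    (x : Site 4 L) (i j : Fin 4) :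
    ‖ρ (plaquetteHolonomy U x i j) - 1‖ ≤ 4 * δ := by
  unfold plaquetteHolonomy
  calc ‖ρ (U (x, i) * U (x.shift i, j) * (U (x.shift j, i))⁻¹ * (U (x, j))⁻¹) - 1‖
      ≤ ‖ρ (U (x, i) * U (x.shift i, j) * (U (x.shift j, i))⁻¹) - 1‖ + ‖ρ (U (x, j))⁻¹ - 1‖ :=
        norm_rho_mul_sub_one_le ρ hU _ _
    _ ≤ ‖ρ (U (x, i) * U (x.shift i, j)) - 1‖ + ‖ρ (U (x.shift j, i))⁻¹ - 1‖ +
          ‖ρ (U (x, j))⁻¹ - 1‖ := by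
        gcongr
        exact norm_rho_mul_sub_one_le ρ hU _ _
    _ ≤ ‖ρ (U (x, i)) - 1‖ + ‖ρ (U (x.shift i, j)) - 1‖ + ‖ρ (U (x.shift j, i))⁻¹ - 1‖ +
          ‖ρ (U (x, j))⁻¹ - 1‖ := by
        gcongr
        exact norm_rho_mul_sub_one_le ρ hU _ _
    _ ≤ δ + δ + δ + δ := by
        rw [norm_rho_inv_sub_one ρ hU, norm_rho_inv_sub_one ρ hU]
        gcongr <;> exact hUδ _
    _ = 4 * δ := by ring

/-- Plaquette energy in Hilbert–Schmidt form: `N − Re tr ρ g = ½ ‖1 − ρ g‖² ≤ η²/2` whenever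
`‖ρ g − 1‖ ≤ η` (unitary `ρ`). -/
theorem sub_re_trace_le (hU : ∀ g, ρ g ∈ Matrix.unitaryGroup (Fin N) ℂ) (g : G) {η : ℝ}
    (h : ‖ρ g - 1‖ ≤ η) : (N : ℝ) - (ρ g).trace.re ≤ η ^ 2 / 2 := by
  have e : (N : ℝ) - (ρ g).trace.re = (Matrix.trace (1 - ρ g)).re := by
    rw [Matrix.trace_sub, Complex.sub_re, Matrix.trace_one, Fintype.card_fin]
    simp
  rw [e, UnitaryCayley.re_trace_one_sub (hU g), norm_sub_rev]
  have h0 : 0 ≤ ‖ρ g - 1‖ := norm_nonneg _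
  gcongr

/-- On the product ball `{∀ e, ‖ρ(U_e) − 1‖ ≤ δ}` the Wilson action is at most `8 δ² #P`. -/
theorem wilsonAction_le_of_ball (hU : ∀ g, ρ g ∈ Matrix.unitaryGroup (Fin N) ℂ)
    {L : ℕ} [NeZero L] {U : GaugeConfig 4 L G} {δ : ℝ} (hUδ : ∀ e, ‖ρ (U e) - 1‖ ≤ δ) :
    wilsonAction ρ U ≤ 8 * δ ^ 2 * Fintype.card (Plaquette 4 L) := by
  unfold wilsonAction
  calc ∑ p : Plaquette 4 L, ((N : ℝ) - (ρ (plaquetteHolonomy U p.1 p.2.1.1 p.2.1.2)).trace.re)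
      ≤ ∑ _p : Plaquette 4 L, 8 * δ ^ 2 := Finset.sum_le_sum fun p _ => by
        have h := sub_re_trace_le ρ hU _
          (norm_rho_plaquetteHolonomy_sub_one_le ρ hU hUδ p.1 p.2.1.1 p.2.1.2)
        have e : (4 * δ) ^ 2 / 2 = 8 * δ ^ 2 := by ring
        linarith
    _ = 8 * δ ^ 2 * Fintype.card (Plaquette 4 L) := by
        rw [Finset.sum_const, Finset.card_univ, nsmul_eq_mul]
        ring

/-- `#E = 4 L⁴` positively oriented edges on `(ℤ/L)⁴`. -/
theorem card_edge (L : ℕ) [NeZero L] : Fintype.card (Edge 4 L) = 4 * L ^ 4 := by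
  rw [Fintype.card_prod, Fintype.card_fun, ZMod.card, Fintype.card_fin]
  ring

/-- `#P = 6 L⁴` plaquettes on `(ℤ/L)⁴` (six coordinate planes `i < j`). -/
theorem card_plaquette (L : ℕ) [NeZero L] : Fintype.card (Plaquette 4 L) = 6 * L ^ 4 := by
  have h6 : Fintype.card {p : Fin 4 × Fin 4 // p.1 < p.2} = 6 := by decide
  rw [Fintype.card_prod, Fintype.card_fun, ZMod.card, Fintype.card_fin, h6]
  ring

end Algebra

section Measure

variable {G : Type*} [Group G] [TopologicalSpace G] [IsTopologicalGroup G] [CompactSpace G]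
  [MeasurableSpace G] [BorelSpace G] {N : ℕ} (ρ : G →* Matrix (Fin N) (Fin N) ℂ)

/-- Product-Haar mass of the product ball: `Haar^{⊗E}{∀ e, ‖ρ(U_e) − 1‖ ≤ δ} = Haar{‖ρ g − 1‖ ≤ δ}^{#E}`. -/
theorem pi_ball_eq (L : ℕ) [NeZero L] (δ : ℝ) :
    Measure.pi (fun _ : Edge 4 L => haarProbability G)
        (Set.pi Set.univ fun _ => {g : G | ‖ρ g - 1‖ ≤ δ}) =
      (haarProbability G {g : G | ‖ρ g - 1‖ ≤ δ}) ^ Fintype.card (Edge 4 L) := by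
  rw [Measure.pi_pi, Finset.prod_const, Finset.card_univ]

/-- **Crude Gaussian lower bound for the torus partition function** (master form): with the
small-ball constant `C₁` of `r`, for all `L`, `β ≥ 0` and `0 < δ ≤ 1`,
`e^{−β · 8 δ² #P} (C₁ δ^D)^{#E} ≤ Z_L(β)`. -/
theorem exp_mul_pow_le_partitionFunction_toReal (r : LatticeRep G) :
    ∃ C₁ : ℝ, 0 < C₁ ∧ ∀ (L : ℕ) [NeZero L] (β δ : ℝ), 0 ≤ β → 0 < δ → δ ≤ 1 →
      Real.exp (-(β * (8 * δ ^ 2 * Fintype.card (Plaquette 4 L)))) *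
          (C₁ * δ ^ dimE r.ρ) ^ Fintype.card (Edge 4 L) ≤
        (partitionFunction (d := 4) (L := L) r.ρ β).toReal := by
  obtain ⟨C₁, hC₁, hball⟩ := exists_haar_gball_ge r.ρ r.continuous r.injective r.mem_unitary
  refine ⟨C₁, hC₁, fun L _ β δ hβ hδ hδ1 => ?_⟩
  have hBsub : (Set.pi Set.univ fun _ : Edge 4 L => {g : G | ‖r.ρ g - 1‖ ≤ δ}) ⊆
      {U : GaugeConfig 4 L G | wilsonAction r.ρ U ≤ 8 * δ ^ 2 * Fintype.card (Plaquette 4 L)} :=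
    fun U hU => wilsonAction_le_of_ball r.ρ r.mem_unitary
      (fun e => (Set.mem_pi.1 hU) e (Set.mem_univ e))
  have h1 : C₁ * δ ^ dimE r.ρ ≤ (haarProbability G {g : G | ‖r.ρ g - 1‖ ≤ δ}).toReal :=
    (ENNReal.ofReal_le_iff_le_toReal (measure_ne_top _ _)).1 (hball δ hδ hδ1)
  have h2 : (C₁ * δ ^ dimE r.ρ) ^ Fintype.card (Edge 4 L) ≤
      (Measure.pi fun _ : Edge 4 L => haarProbability G).real
        (Set.pi Set.univ fun _ : Edge 4 L => {g : G | ‖r.ρ g - 1‖ ≤ δ}) := by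
    rw [measureReal_def, pi_ball_eq r.ρ L δ, ENNReal.toReal_pow]
    exact pow_le_pow_left₀ (by positivity) h1 _
  have h3 : (Measure.pi fun _ : Edge 4 L => haarProbability G).real
        (Set.pi Set.univ fun _ : Edge 4 L => {g : G | ‖r.ρ g - 1‖ ≤ δ}) ≤
      (Measure.pi fun _ : Edge 4 L => haarProbability G).real
        {U : GaugeConfig 4 L G | wilsonAction r.ρ U ≤ 8 * δ ^ 2 * Fintype.card (Plaquette 4 L)} :=
    measureReal_mono hBsub
  rw [partitionFunction_toReal_eq_integral r.ρ r.continuous β]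
  calc Real.exp (-(β * (8 * δ ^ 2 * Fintype.card (Plaquette 4 L)))) *
        (C₁ * δ ^ dimE r.ρ) ^ Fintype.card (Edge 4 L)
      ≤ Real.exp (-β * (8 * δ ^ 2 * Fintype.card (Plaquette 4 L))) *
          (Measure.pi fun _ : Edge 4 L => haarProbability G).real
            {U : GaugeConfig 4 L G |
              wilsonAction r.ρ U ≤ 8 * δ ^ 2 * Fintype.card (Plaquette 4 L)} := by
        rw [neg_mul]
        exact mul_le_mul_of_nonneg_left (h2.trans h3) (Real.exp_pos _).le
    _ ≤ ∫ U, Real.exp (-β * wilsonAction r.ρ U) ∂(Measure.pi fun _ : Edge 4 L => haarProbability G) :=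
        exp_mul_measureReal_le_integral_exp r.ρ r.continuous hβ _

/-- **Crude Gaussian lower bound, `δ = β⁻¹`**: for `β ≥ 1`,
`e^{−48 L⁴} (C₁ β^{−D})^{4 L⁴} ≤ Z_L(β)` — polynomial decay with exponent `4 D L⁴`. -/
theorem partitionFunction_toReal_ge_inv_pow (r : LatticeRep G) :
    ∃ C₁ : ℝ, 0 < C₁ ∧ ∀ (L : ℕ) [NeZero L] (β : ℝ), 1 ≤ β →
      Real.exp (-(48 * (L : ℝ) ^ 4)) * (C₁ * β⁻¹ ^ dimE r.ρ) ^ (4 * L ^ 4) ≤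
        (partitionFunction (d := 4) (L := L) r.ρ β).toReal := by
  obtain ⟨C₁, hC₁, h⟩ := exp_mul_pow_le_partitionFunction_toReal r
  refine ⟨C₁, hC₁, fun L _ β hβ => ?_⟩
  have hβ0 : 0 < β := by linarith
  have hmain := h L β β⁻¹ hβ0.le (inv_pos.2 hβ0) (inv_le_one_of_one_le₀ hβ)
  rw [card_edge, card_plaquette] at hmain
  refine le_trans (mul_le_mul_of_nonneg_right (Real.exp_le_exp.2 ?_) (by positivity)) hmain
  -- `β · 8 β⁻² · 6 L⁴ = 48 L⁴ β⁻¹ ≤ 48 L⁴`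
  have e : β * (8 * β⁻¹ ^ 2 * ((6 * L ^ 4 : ℕ) : ℝ)) = 48 * (L : ℝ) ^ 4 * β⁻¹ := by
    field_simp
    push_cast
    ring
  rw [e, neg_le_neg_iff]
  have hL : (0 : ℝ) ≤ 48 * (L : ℝ) ^ 4 := by positivity
  calc 48 * (L : ℝ) ^ 4 * β⁻¹ ≤ 48 * (L : ℝ) ^ 4 * 1 :=
        mul_le_mul_of_nonneg_left (inv_le_one_of_one_le₀ hβ) hL
    _ = 48 * (L : ℝ) ^ 4 := mul_one _

/-- **Crude Gaussian lower bound, `δ = (√β)⁻¹`** (the Gaussian scale): for `β ≥ 1`,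
`e^{−48 L⁴} (C₁ (√β)^{−D})^{4 L⁴} ≤ Z_L(β)` — polynomial decay with exponent `2 D L⁴`. -/
theorem partitionFunction_toReal_ge_inv_sqrt_pow (r : LatticeRep G) :
    ∃ C₁ : ℝ, 0 < C₁ ∧ ∀ (L : ℕ) [NeZero L] (β : ℝ), 1 ≤ β →
      Real.exp (-(48 * (L : ℝ) ^ 4)) * (C₁ * (Real.sqrt β)⁻¹ ^ dimE r.ρ) ^ (4 * L ^ 4) ≤
        (partitionFunction (d := 4) (L := L) r.ρ β).toReal := by
  obtain ⟨C₁, hC₁, h⟩ := exp_mul_pow_le_partitionFunction_toReal r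
  refine ⟨C₁, hC₁, fun L _ β hβ => ?_⟩
  have hβ0 : 0 < β := by linarith
  have hs0 : 0 < Real.sqrt β := Real.sqrt_pos.2 hβ0
  have hs1 : 1 ≤ Real.sqrt β := by
    rw [← Real.sqrt_one]; exact Real.sqrt_le_sqrt hβ
  have hmain := h L β (Real.sqrt β)⁻¹ hβ0.le (inv_pos.2 hs0) (inv_le_one_of_one_le₀ hs1)
  rw [card_edge, card_plaquette] at hmain
  refine le_trans (le_of_eq ?_) hmain
  congr 2
  -- `β · 8 (√β)⁻² · 6 L⁴ = 48 L⁴`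
  rw [inv_pow, Real.sq_sqrt hβ0.le]
  field_simp
  push_cast
  ring

end Measure

section RealAnalysis

variable {Z : ℝ → ℝ} {C lam : ℝ} {m : ℕ}

/-- **The index of regular variation is bounded by any polynomial lower bound**: if
`Z(β) β^λ/(log β)^m → C` and `c ≤ Z(β) βⁿ` for `β ≥ 1` with `c > 0`, then `λ ≤ n` — otherwise
`c β^{λ−n} ≤ Z(β) β^λ ≤ (|C| + 1)(log β)^m` contradicts `(log β)^m = o(β^{λ−n})`. -/
theorem index_le_of_lowerBound
    (hT : Tendsto (fun β => Z β * β ^ lam / Real.log β ^ m) atTop (𝓝 C)) {c : ℝ} {n : ℕ}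
    (hc : 0 < c) (hlow : ∀ β : ℝ, 1 ≤ β → c ≤ Z β * β ^ n) : lam ≤ n := by
  by_contra hlt
  push Not at hlt
  have hε0 : 0 < lam - n := sub_pos.2 hlt
  obtain ⟨a₁, ha₁⟩ := eventually_atTop.1
    (hT.eventually_le_const (show C < |C| + 1 by linarith [le_abs_self C]))
  have hκ : 0 < c / (2 * (|C| + 1)) := by positivity
  obtain ⟨a₂, ha₂⟩ := eventually_atTop.1 ((isLittleO_log_rpow_rpow_atTop (m : ℝ) hε0).def hκ)
  set β : ℝ := max (max a₁ a₂) 2 with hβ_def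
  have hβ2 : 2 ≤ β := le_max_right _ _
  have hβa₁ : a₁ ≤ β := (le_max_left _ _).trans (le_max_left _ _)
  have hβa₂ : a₂ ≤ β := (le_max_right _ _).trans (le_max_left _ _)
  have hβ0 : 0 < β := by linarith
  have hlog : 0 < Real.log β := Real.log_pos (by linarith)
  have hlogm : 0 < Real.log β ^ m := pow_pos hlog m
  have h1 : Z β * β ^ lam / Real.log β ^ m ≤ |C| + 1 := ha₁ β hβa₁
  rw [div_le_iff₀ hlogm] at h1
  have h2 : ‖Real.log β ^ (m : ℝ)‖ ≤ c / (2 * (|C| + 1)) * ‖β ^ (lam - n)‖ := ha₂ β hβa₂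
  rw [Real.norm_of_nonneg (Real.rpow_nonneg hlog.le _),
    Real.norm_of_nonneg (Real.rpow_nonneg hβ0.le _), Real.rpow_natCast] at h2
  have h3 : c ≤ Z β * β ^ n := hlow β (by linarith)
  have hsplit : β ^ lam = β ^ (lam - (n : ℝ)) * β ^ n := by
    rw [← Real.rpow_natCast β n, ← Real.rpow_add hβ0]
    congr 1
    ring
  have hpos : 0 < β ^ (lam - (n : ℝ)) := Real.rpow_pos_of_pos hβ0 _
  have key : c * β ^ (lam - (n : ℝ)) ≤ c / 2 * β ^ (lam - (n : ℝ)) :=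
    calc c * β ^ (lam - (n : ℝ)) ≤ Z β * β ^ n * β ^ (lam - (n : ℝ)) :=
          mul_le_mul_of_nonneg_right h3 hpos.le
      _ = Z β * β ^ lam := by rw [hsplit]; ring
      _ ≤ (|C| + 1) * Real.log β ^ m := h1
      _ ≤ (|C| + 1) * (c / (2 * (|C| + 1)) * β ^ (lam - (n : ℝ))) :=
          mul_le_mul_of_nonneg_left h2 (by positivity)
      _ = c / 2 * β ^ (lam - (n : ℝ)) := by field_simp
  have : c ≤ c / 2 := le_of_mul_le_mul_right key hpos
  linarith

/-- **Eventual doubling from regular variation**: if `Z(β) β^λ/(log β)^m → C > 0` then for all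
large `β`, `Z(β/2) ≤ 4 · 2^λ · Z(β)` (`log(β/2) ≤ log β`; eventually `Z(β/2) (β/2)^λ ≤
2C (log(β/2))^m` and `(C/2)(log β)^m ≤ Z(β) β^λ`). -/
theorem le_mul_of_tendsto (hC : 0 < C)
    (hT : Tendsto (fun β => Z β * β ^ lam / Real.log β ^ m) atTop (𝓝 C)) :
    ∃ B : ℝ, ∀ β : ℝ, B ≤ β → Z (β / 2) ≤ 4 * 2 ^ lam * Z β := by
  obtain ⟨a₁, ha₁⟩ := eventually_atTop.1 (hT.eventually_const_le (show C / 2 < C by linarith))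
  obtain ⟨a₂, ha₂⟩ := eventually_atTop.1 (hT.eventually_le_const (show C < 2 * C by linarith))
  refine ⟨max (max a₁ (2 * a₂)) 4, fun β hβ => ?_⟩
  have hβ4 : 4 ≤ β := (le_max_right _ _).trans hβ
  have hβa₁ : a₁ ≤ β := ((le_max_left _ _).trans (le_max_left _ _)).trans hβ
  have hβa₂ : a₂ ≤ β / 2 := by
    have : 2 * a₂ ≤ β := ((le_max_right _ _).trans (le_max_left _ _)).trans hβ
    linarith
  have hβ0 : 0 < β := by linarith
  have hlog : 0 < Real.log β := Real.log_pos (by linarith)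
  have hlog2 : 0 < Real.log (β / 2) := Real.log_pos (by linarith)
  have hlogm : 0 < Real.log β ^ m := pow_pos hlog m
  have hlog2m : 0 < Real.log (β / 2) ^ m := pow_pos hlog2 m
  have hβlam : 0 < β ^ lam := Real.rpow_pos_of_pos hβ0 lam
  have h2lam : 0 < (2 : ℝ) ^ lam := Real.rpow_pos_of_pos two_pos lam
  have h1 : C / 2 ≤ Z β * β ^ lam / Real.log β ^ m := ha₁ β hβa₁
  rw [le_div_iff₀ hlogm] at h1
  have h2 : Z (β / 2) * (β / 2) ^ lam / Real.log (β / 2) ^ m ≤ 2 * C := ha₂ (β / 2) hβa₂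
  rw [div_le_iff₀ hlog2m, Real.div_rpow hβ0.le zero_le_two] at h2
  have hlogle : Real.log (β / 2) ^ m ≤ Real.log β ^ m :=
    pow_le_pow_left₀ hlog2.le (Real.log_le_log (by linarith) (by linarith)) m
  have key : Z (β / 2) * β ^ lam ≤ 4 * 2 ^ lam * Z β * β ^ lam :=
    calc Z (β / 2) * β ^ lam = Z (β / 2) * (β ^ lam / 2 ^ lam) * 2 ^ lam := by
          rw [mul_assoc, div_mul_cancel₀ _ h2lam.ne']
      _ ≤ 2 * C * Real.log (β / 2) ^ m * 2 ^ lam := mul_le_mul_of_nonneg_right h2 h2lam.le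
      _ ≤ 2 * C * Real.log β ^ m * 2 ^ lam :=
          mul_le_mul_of_nonneg_right (mul_le_mul_of_nonneg_left hlogle (by positivity)) h2lam.le
      _ = 4 * 2 ^ lam * (C / 2 * Real.log β ^ m) := by ring
      _ ≤ 4 * 2 ^ lam * (Z β * β ^ lam) := mul_le_mul_of_nonneg_left h1 (by positivity)
      _ = 4 * 2 ^ lam * Z β * β ^ lam := by ring
  exact le_of_mul_le_mul_right key hβlam

/-- `4 · 2^λ ≤ e^{λ + 2}` for `λ ≥ 0` (`2 ≤ e`). -/
theorem four_mul_two_rpow_le_exp {lam : ℝ} (hlam : 0 ≤ lam) :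
    4 * (2 : ℝ) ^ lam ≤ Real.exp (lam + 2) := by
  have he : (2 : ℝ) ≤ Real.exp 1 := by linarith [Real.add_one_le_exp (1 : ℝ)]
  have h2e : (2 : ℝ) ^ lam ≤ Real.exp lam := by
    have h := Real.rpow_le_rpow zero_le_two he hlam
    rwa [Real.exp_one_rpow] at h
  have h4 : (4 : ℝ) ≤ Real.exp 2 := by
    have e : Real.exp 2 = Real.exp 1 * Real.exp 1 := by rw [← Real.exp_add]; norm_num
    rw [e]
    nlinarith [Real.exp_pos (1 : ℝ)]
  calc 4 * (2 : ℝ) ^ lam ≤ Real.exp 2 * Real.exp lam := mul_le_mul h4 h2e (by positivity) (by positivity)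
    _ = Real.exp (lam + 2) := by rw [← Real.exp_add]; ring_nf

end RealAnalysis

end Summit.QuantumFields.YangMills.Theorems.FemtoCurvatureTwoPoint.DoublingOfRV

namespace Summit.QuantumFields.YangMills.Theorems.FemtoCurvatureTwoPoint

open DoublingOfRV

/-- **Stub `stub_doubling_of_RV`** (registered, verbatim): regular variation of the fixed-torus
Wilson partition function at `β = ∞` (the hypothesis, a named fact) implies the doubling
`Z_L(β/2) ≤ e^{A L⁴} Z_L(β)` for `β ≥ B(L)` with ONE `A = 4 · dimE r.ρ + 2` for all tori: the crude
Gaussian lower bound caps the index by `4 D L⁴`, and the two limits at `β/2` and `β` give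
`Z(β/2) ≤ 4 · 2^λ Z(β)` eventually. -/
theorem stub_doubling_of_RV :
    (∀ (G : Type) [Group G] [TopologicalSpace G] [IsTopologicalGroup G] [CompactSpace G]
          [MeasurableSpace G] [BorelSpace G] (r : LatticeRep G) (L : ℕ) [NeZero L],
        ∃ (C lam : ℝ) (m : ℕ), 0 < C ∧ 0 ≤ lam ∧
          Tendsto (fun β : ℝ =>
            (partitionFunction (d := 4) (L := L) r.ρ β).toReal * β ^ lam / Real.log β ^ m)
            atTop (nhds C)) →
    ∀ (G : Type) [Group G] [TopologicalSpace G] [IsTopologicalGroup G] [CompactSpace G]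
        [MeasurableSpace G] [BorelSpace G] (r : LatticeRep G), ∃ A : ℝ, ∀ (L : ℕ) [NeZero L],
      ∃ B : ℝ, ∀ β : ℝ, B ≤ β →
        (partitionFunction (d := 4) (L := L) r.ρ (β / 2)).toReal ≤
          Real.exp (A * (L : ℝ) ^ 4) * (partitionFunction (d := 4) (L := L) r.ρ β).toReal := by
  intro hRV G _ _ _ _ _ _ r
  obtain ⟨C₁, hC₁, hLB⟩ := partitionFunction_toReal_ge_inv_pow r
  refine ⟨4 * (dimE r.ρ : ℝ) + 2, fun L _ => ?_⟩
  obtain ⟨C, lam, m, hC, hlam0, hT⟩ := hRV G r L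
  -- the polynomial lower bound `c ≤ Z_L(β) βⁿ`, `n = D · 4L⁴`, `β ≥ 1`
  have hlow : ∀ β : ℝ, 1 ≤ β → Real.exp (-(48 * (L : ℝ) ^ 4)) * C₁ ^ (4 * L ^ 4) ≤
      (partitionFunction (d := 4) (L := L) r.ρ β).toReal * β ^ (dimE r.ρ * (4 * L ^ 4)) := by
    intro β hβ
    have hβn : 0 < β ^ (dimE r.ρ * (4 * L ^ 4)) := pow_pos (by linarith) _
    have h := hLB L β hβ
    rw [mul_pow, ← pow_mul, inv_pow, ← mul_assoc] at h
    calc Real.exp (-(48 * (L : ℝ) ^ 4)) * C₁ ^ (4 * L ^ 4)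
        = Real.exp (-(48 * (L : ℝ) ^ 4)) * C₁ ^ (4 * L ^ 4) * (β ^ (dimE r.ρ * (4 * L ^ 4)))⁻¹ *
            β ^ (dimE r.ρ * (4 * L ^ 4)) := by rw [inv_mul_cancel_right₀ hβn.ne']
      _ ≤ (partitionFunction (d := 4) (L := L) r.ρ β).toReal * β ^ (dimE r.ρ * (4 * L ^ 4)) :=
          mul_le_mul_of_nonneg_right h hβn.le
  have hlam := index_le_of_lowerBound hT (by positivity) hlow
  obtain ⟨B, hB⟩ := le_mul_of_tendsto hC hT
  refine ⟨B, fun β hβ => (hB β hβ).trans (mul_le_mul_of_nonneg_right ?_ ENNReal.toReal_nonneg)⟩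
  -- `4 · 2^λ ≤ e^{λ + 2} ≤ e^{(4D + 2) L⁴}`
  refine (four_mul_two_rpow_le_exp hlam0).trans (Real.exp_le_exp.2 ?_)
  have hL1 : (1 : ℝ) ≤ (L : ℝ) ^ 4 :=
    one_le_pow₀ (by exact_mod_cast Nat.one_le_iff_ne_zero.2 (NeZero.ne L))
  have hlam' : lam ≤ 4 * (dimE r.ρ : ℝ) * (L : ℝ) ^ 4 := hlam.trans (le_of_eq (by push_cast; ring))
  have e : (4 * (dimE r.ρ : ℝ) + 2) * (L : ℝ) ^ 4 =
      4 * (dimE r.ρ : ℝ) * (L : ℝ) ^ 4 + 2 * (L : ℝ) ^ 4 := by ring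
  rw [e]
  linarith

end Summit.QuantumFields.YangMills.Theorems.FemtoCurvatureTwoPoint

end
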